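import Summits.BirchSwinnertonDyer.BirchSwinnertonDyer.Theses.SemiOrdinaryEisensteinDescent
import Summits.BirchSwinnertonDyer.BirchSwinnertonDyer.Theorems.WildThreeRankOneBSDpOfExactIndexManin
import Summits.BirchSwinnertonDyer.BirchSwinnertonDyer.Theorems.SchneiderFreeAdditiveX3UpperReceptacle
import Summits.BirchSwinnertonDyer.BirchSwinnertonDyer.Theorems.ClassRecordThreeStepLOfHalvesB
import Literature.NumberTheory.EllipticCurves.BSDHeegnerPointsGrossZagierProofs
import Literature.NumberTheory.EllipticCurves.KrizLi2019.SexticTwistBSDThreeDescent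
import Literature.NumberTheory.EllipticCurves.GlobalMinimalModelProofs
import Literature.NumberTheory.EllipticCurves.ModularCurveManinConstantProofs
import HarnessLib

/-!
# Route `SemiOrdinaryEisensteinDescent`: the route KERNEL re-run WITHOUT the `3`-adic tower split —
# leaf `WAllExclAddWildRankOneSurj` ⟸ published inputs + E′ + Ko′ (Ko with its `TowerSurjThree` binder
# deleted) + V + C + Z, with NO non-tower residual socket; hence the residual crux NT
# `WildRankOneSurjNonTowerAtThree` (stmt-BirchSwinnertonDyer-20484) is a COROLLARY of the other sockets
# (width seat `bsd-wall-soed-p2-w2` g3; `--supports stmt-BirchSwinnertonDyer-20484`, helper)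

WHY. The route kernel (`EisensteinKernelAtThree[Restricted]`, bed-p3 g1 / soed-p1-w3: Jetchev–Skinner–Wan §7.4
at the wild split prime `3`, Manin-robust, one-sided halves) splits on `AdditiveThree.TowerSurjThree W`: off the
tower it invokes the residual crux NT BY NAME; on the tower it runs Friedberg–Hoffstein ⟶ Heegner point ⟶
Gross–Zagier ⟶ Kolyvagin ⟶ frame ⟶ Waldspurger value ⟶ control ⟶ Eisenstein inclusion (lower socket) ⟶ the
Kolyvagin crux Ko `WildKolyvaginUpperAtThree` (upper socket) ⟶ p528981. The tower binder is consumed ONLY by Ko.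
The companion file `…WildKolyvaginUpperAtThreeTowerFree.lean` (this seat) shows that Ko's tower binder is IDLE
on the McCallum road (the tree's derivation of McCallum's Cor. 5.6 upper half takes the mod-`3` image only):
Ko′ := Ko with `TowerSurjThree W →` deleted follows from J′ := J with the same binder deleted and the three
primitives {Cassels–Tate level inputs, Gross 3.7 (2), GZ86 III (3.1)}. This file re-runs the kernel with Ko′
for Ko and NO tower split:

* `wAllExclAddWildRankOneSurj_of_koTowerFree` — `PublishedInputsWildThree → E′
  (`WildSplitEisensteinInclusionAtThreeRestricted`) → Ko′ (displayed) → WildSplitWaldspurgerAtThree →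
  WildSplitControlAtThree → WildRankZeroTwistAtThree → WAllExclAddWildRankOneSurj` (bed-p3 g1's proof VERBATIM
  minus step (o), with `hupI` from Ko′);
* `wildRankOneSurjNonTowerAtThree_of_koTowerFree` — **NT BY NAME ⟸ the same five sockets** (NT is the leaf
  restricted to `¬ TowerSurjThree W`);
* `eisensteinKernelAtThreeRestricted_of_koTowerFree` — the route's restricted kernel item shape with its Ko and
  NT antecedents both discharged from Ko′ (bookkeeping).

CONSEQUENCE FOR THE PEN (route shape; nothing edited here): restating Ko ↦ Ko′ and J ↦ J′ (delete the binder
`Summit.BirchSwinnertonDyer.Rank1Residual.AdditiveThree.TowerSurjThree W →` in items 20480 / 20760) makes NT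
20484 derivable (this file) and the kernel tower-free; the route's open research content is then
{J′ (wall: Σ-form refined Kolyvagin at additive 3 ⊕ Manin₃), E′, V, C, Z} with no separate «mod-9 defect»
residual. HONEST FRAMING: every crux is an ANTECEDENT; Ko′ is displayed, not an item; BSD is not proved for any
curve; no definition, no named fact, no `sorry`.

References: [JetchevSkinnerWan2017] §7.4.1 (arXiv:1512.06894 p. 30); [Castella2018] Thm. 2.3, §5 (5.1)–(5.3);
[GrossZagier1986] Thm. I.(6.3), V.§2; [FriedbergHoffstein1995] Thm. B; [McCallumLMS1991] §5 Cor. 5.6;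
[Elkies2006] (curves onto mod 3, not mod 9).
-/

noncomputable section

open scoped Classical

set_option linter.dupNamespace false -- `Summit.BirchSwinnertonDyer.BirchSwinnertonDyer.Theorems.…` (summit = sub)
set_option autoImplicit false

namespace Summit.BirchSwinnertonDyer.BirchSwinnertonDyer.Theorems.EisensteinKernelAtThreeTowerFree

open WeierstrassCurve NumberField IsDedekindDomain Field PowerSeries
  Literature.NumberTheory.EllipticCurves
  Literature.NumberTheory.EllipticCurves.ModularForms
  Literature.NumberTheory.EllipticCurves.Rank1Residual
  Literature.NumberTheory.EllipticCurves.KrizLi2019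
  Summit.BirchSwinnertonDyer.Rank1Residual
  Summit.BirchSwinnertonDyer.Rank1Residual.Additive
  Summit.BirchSwinnertonDyer.Rank1Residual.X11b
  Summit.BirchSwinnertonDyer.Rank1Residual.X11b.AcSelmer
  Summit.BirchSwinnertonDyer.Rank1Residual.X11b.Halves
  Summit.BirchSwinnertonDyer.BirchSwinnertonDyer.Theses.SemiOrdinaryEisensteinDescent
  Summit.BirchSwinnertonDyer.BirchSwinnertonDyer.Theorems

/-- **SOED's leaf from E′ + the TOWER-FREE Kolyvagin socket Ko′ + V + C + Z — NO non-tower residual.**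
`PublishedInputsWildThree → WildSplitEisensteinInclusionAtThreeRestricted → Ko′ → WildSplitWaldspurgerAtThree →
WildSplitControlAtThree → WildRankZeroTwistAtThree → WAllExclAddWildRankOneSurj`, where `hKo'` is the crux Ko
`WildKolyvaginUpperAtThree` (stmt-20480) VERBATIM with its binder `AdditiveThree.TowerSurjThree W →` DELETED.
bed-p3 g1's kernel (`semiOrdinaryEisensteinDescent_eisensteinKernelAtThree_proof`) VERBATIM with the Eisenstein
step fed by the RESTRICTED crux E′ at the Friedberg–Hoffstein field (as in soed-p1-w3's
`wAllExclAddWildRankOneSurj_of_restricted`), except that step (o) (the split on the `3`-adic tower and the call to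
NT) is GONE: the upper socket `Upper.IndexUpperBoundLeAt W 3 K P (v₃ c)` is taken
from Ko′ at the Friedberg–Hoffstein field with no image input beyond `ρ̄_{E,3}` onto. Every crux is an antecedent;
BSD is not proved by this. [cite: JetchevSkinnerWan2017, §7.4.1 (arXiv:1512.06894 p. 30)]
[cite: Castella2018, Thm. 2.3 and §5 (5.1)–(5.3)] [cite: GrossZagier1986, Thm. I.(6.3) and V.§2]
[cite: FriedbergHoffstein1995, Thm. B] -/
theorem wAllExclAddWildRankOneSurj_of_koTowerFree (hF : PublishedInputsWildThree)
    (hE' : WildSplitEisensteinInclusionAtThreeRestricted)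
    (hKo' : ∀ (W : WeierstrassCurve ℚ) [W.IsElliptic] [W.IsGloballyMinimal] (N : ℕ) [NeZero N] (K : Type)
      [Field K] [NumberField K] (Dt : ModularParametrizationData W N)
      (H : HeegnerDatum N (NumberField.discr K)) (ι : K →+* ℂ) (P : (W.baseChange K).toAffine.Point),
      ClassO6 W 3 → W.HasSurjectiveModNGaloisRep 3 → W.analyticRank = 1 → W.conductorNorm ℤ = N →
      IsImaginaryQuadratic K → SatisfiesHeegnerHypothesis N K →
      (W.quadraticTwist (NumberField.discr K : ℚ)).entireLFunction 1 ≠ 0 →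
      WeierstrassCurve.Affine.Point.map ι.toRatAlgHom P = heegnerPointComplex Dt H →
      ¬ IsOfFinAddOrder P → Odd (NumberField.discr K) → NumberField.discr K ≠ -3 →
      SchneiderFree.Upper.IndexUpperBoundLeAt W 3 K P (padicValNat 3 Dt.c.natAbs))
    (hV : WildSplitWaldspurgerAtThree) (hC : WildSplitControlAtThree) (hZ : WildRankZeroTwistAtThree) :
    Summit.BirchSwinnertonDyer.WAllExclAddWildRankOneSurj := by
  unfold Summit.BirchSwinnertonDyer.WAllExclAddWildRankOneSurj
  intro W _ _ hncm hO6 hsurj hr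
  -- NO tower split: the argument below uses the mod-`3` image only
  obtain ⟨hGZ, hKo, hGZK, hmod, hmodP, -, hGZ73, hFH, hpar, hHP⟩ := hF
  haveI hN0 : NeZero (W.conductorNorm ℤ) := ⟨W.conductorNorm_pos_holds.ne'⟩
  -- (a) DATA. parity: `r_an = 1` is odd, so `w(E) = -1`
  have hw : W.rootNumber = -1 := by
    rcases W.rootNumber_eq_one_or with h | h
    · exfalso
      have heven : Even W.analyticRank := (hpar W).mpr h
      rw [hr] at heven
      exact Nat.not_even_one heven
    · exact h
  -- Friedberg–Hoffstein with auxiliary modulus `2`: Heegner for `N(E)`, `2` split, `L(E^{(d_K)},1) ≠ 0`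
  obtain ⟨K, _, _, hK, -, hHN, hH2, hLt⟩ := hFH W hw 2 two_ne_zero 0
  have hodd : Odd (NumberField.discr K) := by
    have h8 := Literature.SatisfiesHeegnerHypothesis.discr_emod_eight hK.1 hH2 (dvd_refl 2)
    rw [Int.odd_iff]; omega
  -- `3 ∣ N(E)` (additive) splits in `K`; hence `d_K ≠ -3`
  have h3N : 3 ∣ W.conductorNorm ℤ :=
    (W.dvd_conductorNorm_iff_not_hasGoodReductionAtPrime 3).mpr (not_good_of_addv W 3 hO6.2.1)
  have hsplit : SplitsIn K 3 := hHN 3 Nat.prime_three h3N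
  have hd3 : NumberField.discr K ≠ -3 := by
    intro h
    exact Literature.SatisfiesHeegnerHypothesis.not_dvd_discr hK.1 hHN Nat.prime_three h3N
      (by rw [h]; norm_num)
  -- the Heegner point over `K` and its datum; non-torsion by Gross–Zagier
  obtain ⟨P, Dt, H, ι, hP⟩ := hHP W K hK hHN
  have hL0 : W.entireLFunction 1 = 0 := entireLFunction_one_eq_zero_of_analyticRank_eq_one hr
  obtain ⟨-, hderiv⟩ := leadingLCoeff_eq_deriv_of_analyticRank_eq_one hr
  have hLK : LDerivEK W K ≠ 0 := by
    rw [lDerivEK_eq_deriv_mul W K hmod hL0]; exact mul_ne_zero hderiv hLt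
  have hnt : ¬ IsOfFinAddOrder P :=
    (lDerivEK_ne_zero_iff_not_isOfFinAddOrder W (W.conductorNorm ℤ) K (hGZ _ W K) hK hHN
      ⟨Dt, H, ι, hP⟩).mp hLK
  -- Kolyvagin: `rank E(K) = 1`, `Ш(E/K)` finite
  obtain ⟨hrk, hfin⟩ := hKo (W.conductorNorm ℤ) W K hK hHN ⟨Dt, H, ι, hP⟩ hnt
  -- a frame `(κ, γ, 𝔭)` and the other prime `𝔭′ ≠ 𝔭` above `3`
  obtain ⟨κ, γ, -, hκ, hγ, -⟩ := X11b.exists_anticyclotomic_generator_prime (p := 3) hK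
  haveI : Fact (κ.IsTopGenerator γ) := ⟨hγ⟩
  obtain ⟨𝔭, h𝔭, he, hf⟩ := X11b.exists_degreeOnePrime_of_splitsIn K 3 hK.1 hsplit
  obtain ⟨𝔭', hne, h𝔭', he', hf'⟩ := X11b.Three.exists_ne_degreeOne_prime hK.1 h𝔭 he hf
  -- (b) PLUMBING. Waldspurger frame and unit value at `(κ, γ, 𝔭)`
  obtain ⟨ι', hind, ΩK, Ωp, L, hΩK, hΩp, hBDP, u, hval⟩ :=
    hV W (W.conductorNorm ℤ) K Dt H ι P hO6 hsurj hr rfl hK hHN hLt hP hnt κ hκ γ 𝔭 h𝔭 he hf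
  -- control count at `𝔭′` (CTL₀ included; supplies the torsion guard of the Eisenstein residual)
  have hctl : SchneiderFree.AdditiveControlOnTreeAt 3 κ 𝔭' γ (embAt K 3 𝔭' h𝔭' he' hf') P :=
    hC W (W.conductorNorm ℤ) K Dt H ι P hO6 hsurj hr rfl hK hHN hLt hP hnt (hKo _ W K) κ hκ γ 𝔭'
      h𝔭' he' hf'
  obtain ⟨n, hn, hneq⟩ := hctl
  -- the RESTRICTED Eisenstein inclusion `Ch_Λ(X_(∅,0))·R₀⟦T⟧ ⊆ (L)` at the frame (crux E′, torsion-guarded;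
  -- its datum binders `H, ι, P`, `L(E^{(d_K)},1) ≠ 0`, `P = y_K`, `P` non-torsion are in hand here)
  have hincl : (XAc.charIdeal (W.baseChange K) 3 κ 𝔭' ∅ γ).map (PowerSeries.map (toUnr 3)) ≤
      Ideal.span {L} :=
    hE' W (W.conductorNorm ℤ) K Dt H ι P hO6 hsurj hr rfl hK hHN hLt hP hnt κ hκ γ 𝔭 h𝔭 he hf 𝔭' h𝔭' hne
      ι' hind ΩK Ωp L hΩK hΩp hBDP hn.1
  -- the value read through the logarithm at `𝔭′` (rank one: `(log_{𝔭′} P)² = (log_𝔭 P)²`)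
  have hval' : L.HasValueAt 0 ((((u : unrIntegers 3) : unrIntegers 3) : ℂ_[3]) *
      (algebraMap ℚ_[3] ℂ_[3]
        (logOmega W 3 (embAt K 3 𝔭' h𝔭' he' hf') P / (Dt.c : ℚ_[3]))) ^ 2) :=
    (SchneiderFreeAdditiveX3.hasValueAt_sq_logOmega_embAt_iff_of_rank_one W 3 hK.1 hrk h𝔭 he hf
      h𝔭' he' hf' P _ _ L).mpr hval
  -- the LOWER socket at slack `v₃(c)` at the frame `(κ, 𝔭′, γ, embAt 𝔭′)`
  have hc0 : Dt.c ≠ 0 := Dt.maninConstant_ne_zero_holds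
  have hlog : logOmega W 3 (embAt K 3 𝔭' h𝔭' he' hf') P ≠ 0 := X11b.R1.logOmega_ne_zero W 3 _ hnt
  have hlow : SchneiderFree.AdditiveIMCLowerBDPOnTreeLeAt 3 κ 𝔭' γ (embAt K 3 𝔭' h𝔭' he' hf')
      (padicValNat 3 Dt.c.natAbs) P := by
    -- the LOWER norm receptacle (`⊆` + value): `2·ord₃(log_{𝔭′}P / c) ≤ ord₃ f(0)`
    obtain ⟨htors, f, hfI, hf0, hfn⟩ := hn
    have hmem : PowerSeries.map (toUnr 3) f ∈ Ideal.span {L} := by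
      have h3 := hincl
      rw [hfI, CongruenceLimit.map_span_singleton_powerSeries] at h3
      exact (Ideal.span_singleton_le_iff_mem _).mp h3
    obtain ⟨-, hle⟩ := Supersingular.two_mul_valuation_le_of_mem_span 3 hf0 hmem u hval'
    have hc0' : (Dt.c : ℚ_[3]) ≠ 0 := by exact_mod_cast hc0
    rw [div_eq_mul_inv, Padic.valuation_mul hlog (inv_ne_zero hc0'), Padic.valuation_inv,
      Padic.valuation_intCast, valuation_logOmega hlog, hfn] at hle
    refine ⟨n, ⟨htors, f, hfI, hf0, hfn⟩, ?_⟩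
    simp only [padicValInt] at hle
    linarith
  have hlo : SchneiderFree.IndexLowerBoundLeAt W 3 K P (padicValNat 3 Dt.c.natAbs) :=
    SchneiderFreeAdditiveX3.indexLowerBoundLeAt_of_imcLowerLe_of_control rfl hK hHN hfin hlow
      ⟨n, hn, hneq⟩
  -- the UPPER socket at slack `v₃(c)` is Ko′ — image input `ρ̄_{E,3}` onto ONLY, no tower
  have hupI : SchneiderFree.Upper.IndexUpperBoundLeAt W 3 K P (padicValNat 3 Dt.c.natAbs) :=
    hKo' W (W.conductorNorm ℤ) K Dt H ι P hO6 hsurj hr rfl hK hHN hLt hP hnt hodd hd3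
  -- (c) TERMINAL STEP: a globally minimal model of the twist, then p528981
  have hD0 : (NumberField.discr K : ℚ) ≠ 0 := by exact_mod_cast NumberField.discr_ne_zero K
  haveI : (W.quadraticTwist (NumberField.discr K : ℚ)).IsElliptic := W.isElliptic_quadraticTwist hD0
  obtain ⟨Cd, hCd⟩ := hasGlobalMinimalModel_rat_holds (W.quadraticTwist (NumberField.discr K : ℚ))
  haveI : (Cd • W.quadraticTwist (NumberField.discr K : ℚ)).IsGloballyMinimal := hCd
  exact SchneiderFree.Exact.bsdp_three_of_exactIndexManin_of_wAllExclAddWildRankZero hGZ hKo hGZK hmod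
    hGZ73 hZ W hO6 hsurj hr (W.conductorNorm ℤ) K Dt H ι P
    (Cd • W.quadraticTwist (NumberField.discr K : ℚ)) rfl hK hodd hHN hLt hP ⟨Cd, rfl⟩ hlo hupI

/-- **The residual crux NT `WildRankOneSurjNonTowerAtThree` (stmt-BirchSwinnertonDyer-20484) BY NAME ⟸
published inputs + E′ + Ko′ + V + C + Z** — NT is the leaf `WAllExclAddWildRankOneSurj` restricted to the rows
with `¬ TowerSurjThree W`, and the tower-free kernel above pays the whole leaf. So the onto-mod-`3`,
not-onto-mod-`9` rows (Elkies' defect) need NO mechanism of their own: modulo the route's other sockets they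
cost exactly Ko′, i.e. (companion file) J′ + {Cassels–Tate level inputs, Gross 3.7 (2), GZ86 III (3.1)}. Every
crux is an antecedent; BSD is not proved by this. [cite: JetchevSkinnerWan2017, §7.4.1 (arXiv:1512.06894 p. 30)]
[cite: McCallumLMS1991, §5 Cor. 5.6 (p. 310)] -/
theorem wildRankOneSurjNonTowerAtThree_of_koTowerFree (hF : PublishedInputsWildThree)
    (hE' : WildSplitEisensteinInclusionAtThreeRestricted)
    (hKo' : ∀ (W : WeierstrassCurve ℚ) [W.IsElliptic] [W.IsGloballyMinimal] (N : ℕ) [NeZero N] (K : Type)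
      [Field K] [NumberField K] (Dt : ModularParametrizationData W N)
      (H : HeegnerDatum N (NumberField.discr K)) (ι : K →+* ℂ) (P : (W.baseChange K).toAffine.Point),
      ClassO6 W 3 → W.HasSurjectiveModNGaloisRep 3 → W.analyticRank = 1 → W.conductorNorm ℤ = N →
      IsImaginaryQuadratic K → SatisfiesHeegnerHypothesis N K →
      (W.quadraticTwist (NumberField.discr K : ℚ)).entireLFunction 1 ≠ 0 →
      WeierstrassCurve.Affine.Point.map ι.toRatAlgHom P = heegnerPointComplex Dt H →
      ¬ IsOfFinAddOrder P → Odd (NumberField.discr K) → NumberField.discr K ≠ -3 →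
      SchneiderFree.Upper.IndexUpperBoundLeAt W 3 K P (padicValNat 3 Dt.c.natAbs))
    (hV : WildSplitWaldspurgerAtThree) (hC : WildSplitControlAtThree) (hZ : WildRankZeroTwistAtThree) :
    WildRankOneSurjNonTowerAtThree := by
  have hleaf := wAllExclAddWildRankOneSurj_of_koTowerFree hF hE' hKo' hV hC hZ
  unfold Summit.BirchSwinnertonDyer.WAllExclAddWildRankOneSurj at hleaf
  intro W _ _ hncm hO6 hsurj _hnt hr
  exact hleaf W hncm hO6 hsurj hr

/-- **Bookkeeping: the route's restricted kernel item shape `EisensteinKernelAtThreeRestricted` from Ko′ with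
BOTH its Kolyvagin antecedent and its non-tower antecedent idle** — `PublishedInputsWildThree → E′ → Ko → V → C →
Z → NT → leaf` holds for trivial reasons once Ko′ is granted (the leaf already follows from E′, Ko′, V, C, Z).
Displayed only to make the redundancy of the pair (Ko-with-tower, NT) given Ko′ kernel-visible. [folklore] -/
theorem eisensteinKernelAtThreeRestricted_of_koTowerFree
    (hKo' : ∀ (W : WeierstrassCurve ℚ) [W.IsElliptic] [W.IsGloballyMinimal] (N : ℕ) [NeZero N] (K : Type)
      [Field K] [NumberField K] (Dt : ModularParametrizationData W N)
      (H : HeegnerDatum N (NumberField.discr K)) (ι : K →+* ℂ) (P : (W.baseChange K).toAffine.Point),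
      ClassO6 W 3 → W.HasSurjectiveModNGaloisRep 3 → W.analyticRank = 1 → W.conductorNorm ℤ = N →
      IsImaginaryQuadratic K → SatisfiesHeegnerHypothesis N K →
      (W.quadraticTwist (NumberField.discr K : ℚ)).entireLFunction 1 ≠ 0 →
      WeierstrassCurve.Affine.Point.map ι.toRatAlgHom P = heegnerPointComplex Dt H →
      ¬ IsOfFinAddOrder P → Odd (NumberField.discr K) → NumberField.discr K ≠ -3 →
      SchneiderFree.Upper.IndexUpperBoundLeAt W 3 K P (padicValNat 3 Dt.c.natAbs)) :
    EisensteinKernelAtThreeRestricted :=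
  fun hF hE' _hKo hV hC hZ _hNT ↦ wAllExclAddWildRankOneSurj_of_koTowerFree hF hE' hKo' hV hC hZ

end Summit.BirchSwinnertonDyer.BirchSwinnertonDyer.Theorems.EisensteinKernelAtThreeTowerFree

end
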